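import Literature.AlgebraicGeometry.ComplexMultiplication.RosatiInvolutionOverNumberField
import Literature.RingTheory.CentralSimple.PositiveInvolutionStableSubalgebra
import HarnessLib

/-!
# `End⁰_E(B)` of an abelian variety over a number field is semisimple, and so is every Rosati-stable subalgebra
# (Mumford §19 Cor. 2 / §21 Thm. 1; Milne CM Prop. 1.36) — by the positive anti-involution, without Poincaré reducibility over `E`

Layer `Literature/AlgebraicGeometry/ComplexMultiplication`, namespace `Literature.AlgebraicGeometry.ComplexMultiplication`.
THEOREMS ONLY: no definition, no instance, no named fact, no `sorry` (net Literature debt 0).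

D. Mumford, *Abelian Varieties* (1970), §19 Cor. 2 of Thm. 1 (p. 174): «`End⁰(X)` is a semisimple `ℚ`-algebra» (from Poincaré's
complete reducibility theorem), and §21 Thm. 1 (positivity of the Rosati involution); J. S. Milne, *Complex Multiplication* (2006),
Ch. I Prop. 1.36 (p. 20): a finite-dimensional `ℚ`-algebra with a positive involution — and every involution-stable subalgebra of it — is
semisimple.  The tree proves Mumford §19 Cor. 2 unconditionally over ALGEBRAICALLY CLOSED fields and over FINITE fields
(`Motives/AbelianVarietyEndAlgebraSemisimple`: `isSemisimpleRing_endAlgebra_of_isAlgClosed`, `…_of_finite`); over a NUMBER FIELD the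
conclusion follows at once from the Rosati involution of an `E`-rational polarisation (★ `exists_isPositiveAntiInvolution_endAlgebra`,
`ComplexMultiplication/RosatiInvolutionOverNumberField`) and the generic ★ `IsPositiveAntiInvolution.isSemisimpleRing_subalgebra`
(`RingTheory/CentralSimple/PositiveInvolutionStableSubalgebra` §4):

* `isSemisimpleRing_subalgebra_of_rosati_stable` — every `ℚ`-subalgebra of `End⁰_E(B)` stable under (one of) its Rosati involution(s) is
  semisimple (the «door (α)» of the d6 card: `heckeImage K` is semisimple as soon as it is Rosati-stable);
* **`isSemisimpleRing_endAlgebra_of_numberField`** — `End⁰_E(B)` itself is semisimple, for EVERY abelian variety `B` over a number field `E`.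

USE (cell `hodgecm-mathlib`, D-0151, crux `HLiu418` = stmt-HodgeConjecture-24832, d6 card S2′ DH2): count-neutral capital; moves no book
(HC_CM is proved only modulo the 7 printed citations until rung 0 closes).

## References
* [MumfordAV1970] D. Mumford, *Abelian Varieties* (1970), §19 Cor. 2 of Thm. 1 (p. 174), §21 Thm. 1 (pp. 192–193).
* [MilneCM2006] J. S. Milne, *Complex Multiplication* (2006), Ch. I §1 Prop. 1.36 (p. 20).
* [Shimura1998] G. Shimura, *Abelian Varieties with Complex Multiplication and Modular Functions* (1998), §1.3, §5.1 Prop. 5 (p. 38).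
-/

noncomputable section

open NumberField
open Literature.AlgebraicGeometry.Motives Literature.RingTheory.CentralSimple

namespace Literature.AlgebraicGeometry.ComplexMultiplication

/-- **A Rosati-stable `ℚ`-subalgebra of `End⁰_E(B)` is semisimple** (`B` over a number field `E`): for the positive anti-involution `ι`
of ★ `exists_isPositiveAntiInvolution_endAlgebra` — or any positive anti-involution — every `ι`-stable subalgebra is semisimple
([MilneCM2006] Prop. 1.36, ★ `IsPositiveAntiInvolution.isSemisimpleRing_subalgebra`). [cite: MilneCM2006, Ch. I §1 Prop. 1.36 (p. 20)]
[cite: MumfordAV1970, §21 Thm. 1] -/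
theorem isSemisimpleRing_subalgebra_of_rosati_stable {E : Type} [Field E] [NumberField E] (B : AbelianVariety E)
    {ι : B.endAlgebra →ₗ[ℚ] B.endAlgebra} (hι : IsPositiveAntiInvolution B.endAlgebra ι)
    (H : Subalgebra ℚ B.endAlgebra) (hH : ∀ x ∈ H, ι x ∈ H) : IsSemisimpleRing H :=
  hι.isSemisimpleRing_subalgebra H hH

/-- **Mumford §19 Cor. 2 over a number field, via §21: `End⁰_E(B)` is a semisimple `ℚ`-algebra for every abelian variety `B` over a
number field `E`** — the whole algebra is stable under the Rosati involution of an `E`-rational polarisation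
(★ `exists_isPositiveAntiInvolution_endAlgebra`), hence semisimple ([MilneCM2006] Prop. 1.36), transported from the subalgebra `⊤`
along `Subalgebra.topEquiv`. [cite: MumfordAV1970, §19 Cor. 2 of Thm. 1 (p. 174) and §21 Thm. 1] [cite: MilneCM2006, Ch. I §1 Prop. 1.36 (p. 20)] -/
theorem isSemisimpleRing_endAlgebra_of_numberField {E : Type} [Field E] [NumberField E] (B : AbelianVariety E) :
    IsSemisimpleRing B.endAlgebra := by
  obtain ⟨ι, hι⟩ := exists_isPositiveAntiInvolution_endAlgebra B
  haveI : IsSemisimpleRing (⊤ : Subalgebra ℚ B.endAlgebra) :=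
    hι.isSemisimpleRing_subalgebra ⊤ fun x _ => Algebra.mem_top
  exact (Subalgebra.topEquiv (R := ℚ) (A := B.endAlgebra)).toRingEquiv.isSemisimpleRing

end Literature.AlgebraicGeometry.ComplexMultiplication

end
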